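import Summits.QuantumFields.GaugeBoot.PlanarPlaquetteWalks
import Summits.QuantumFields.GaugeBoot.PlanarClassIdentificationRate
import HarnessLib

/-!
# Words as walks of `ℤ^d`: every cyclically reduced closed word is realised by a non-backtracking closed walk — the walk hypotheses of the large-`N` theorems, discharged by `decide` (gauge-boot, large-`N` supplement 14)

HONEST FRAMING (cell `pub-gaugeboot`, page 1 of every file): the venture produces certified bounds
on lattice expectations at stated coupling, gauge group, dimension and torus size; NOT a mass gap,
NOT a continuum limit, NOT a string tension; NOT large `N` unless marked CONDITIONAL; NOT
Yang–Mills-summit-bearing (barriers `FixedCouplingUltralocality`, `PerturbativeInvisibility`).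
Combinatorial bookkeeping; this file certifies no number.

## Content

The bridge between the lane's word vocabulary (`ClassBWords`: `Word d`, `wordHolonomyZd`) and the
walk vocabulary of Shen–Zhu–Zhu's facts (`Literature.MathematicalPhysics.QuantumLattice.WilsonLoops`:
`SimpleGraph.Walk` of `zdGraph d`, `walkHolonomy`, `IsNonBacktrackingLoop`):

* `Word.toWalkZd x w : (zdGraph d).Walk x (endpointZd x w)` (one dart per letter); ★
  `walkHolonomy_toWalkZd` — SAME HOLONOMY on every configuration; `length_toWalkZd`;
* `Word.CyclicallyReduced w` — non-empty and no letter followed (cyclically) by its inverse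
  (DECIDABLE: `decide` for concrete words); ★★ `isNonBacktrackingLoop_toLoopZd` — a cyclically reduced
  closed word gives a non-backtracking closed walk `Word.toLoopZd x w hw` with the word's holonomy
  (`Step.applyZd_applyZd_eq_iff`: `t·(s·x) = x ↔ t = s⁻¹`);
* hence the hypothesis-light forms of the strong-coupling theorems: ★★ `loopImCov_le_of_szz_of_cyclicallyReduced`
  (`Γ_{μ_N}(C,C) ≤ 4 n(n−3)/(c₀N²)` for every cyclically reduced closed word `C` of length `n`, given SZZ
  (1.12)), `tendsto_loopImCov_zero_of_szz_of_cyclicallyReduced`, and `variance_loopTrZd_le_of_szz_of_cyclicallyReduced`.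

So the walk data `(γ, hγ, hhol)` of `PlanarCertificate.eventually_obj_le_suN_strongCoupling` /
`obj_le_bound_add_div_sq_of_szz` / `abs_loopQ_conjPath_sub_loopQ_le_of_szz` is supplied by
`(Word.toLoopZd x C hC, isNonBacktrackingLoop_toLoopZd …, walkHolonomy_toLoopZd …)` for every cyclically
reduced loop of a certificate (Kazakov–Zheng's loop variables are cyclically reduced words).  [folklore].
-/

noncomputable section

open MeasureTheory ProbabilityTheory Filter Topology
open scoped BigOperators
open Literature.Probability.LatticeModels (Site zdGraph)
open Literature.MathematicalPhysics.QuantumLattice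
open Literature.MathematicalPhysics.QuantumFieldTheory (szzThresholdSU shenZhuZhu_largeN_variance IsNonBacktrackingLoop)
open SimpleGraph

namespace Summit.QuantumFields.GaugeBoot

variable {d N : ℕ}

/-! ## Steps as darts -/

/-- Every step is an edge of `ℤ^d`: `x ∼ s·x`. [folklore] -/
theorem Step.adj_applyZd (x : Site d) (s : Step d) : (zdGraph d).Adj x (s.applyZd x) := by
  cases s with
  | fwd μ => exact zdGraph_adj_add_single x μ
  | bwd μ =>
    have h := (zdGraph_adj_add_single (x - Pi.single μ 1) μ).symm
    rwa [sub_add_cancel] at h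

/-- `eᵢ ≠ eⱼ` for `i ≠ j`. [folklore] -/
private theorem single_ne_single' {i j : Fin d} (hij : i ≠ j) :
    (Pi.single i (1 : ℤ) : Site d) ≠ Pi.single j 1 := by
  intro h
  have := congr_fun h i
  simp [Pi.single_eq_of_ne hij] at this

/-- `eᵢ + eⱼ ≠ 0`. [folklore] -/
private theorem single_add_single_ne_zero' (i j : Fin d) :
    (Pi.single i (1 : ℤ) : Site d) + Pi.single j 1 ≠ 0 := by
  intro h
  have := congr_fun h i
  simp only [Pi.add_apply, Pi.single_eq_same, Pi.zero_apply] at this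
  by_cases hij : j = i
  · subst hij; simp at this
  · rw [Pi.single_eq_of_ne (Ne.symm hij)] at this; omega

/-- **Two steps return to the start iff the second is the inverse of the first**:
`t·(s·x) = x ↔ t = s⁻¹`. [folklore] -/
theorem Step.applyZd_applyZd_eq_iff (x : Site d) (s t : Step d) : t.applyZd (s.applyZd x) = x ↔ t = s.inv := by
  constructor
  · intro h
    cases s with
    | fwd μ =>
      cases t with
      | fwd ν =>
        exfalso; apply single_add_single_ne_zero' μ ν
        simp only [Step.applyZd_fwd] at h
        linear_combination h
      | bwd ν =>
        by_cases hμν : μ = ν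
        · subst hμν; rfl
        · exfalso; apply single_ne_single' hμν
          simp only [Step.applyZd_fwd, Step.applyZd_bwd] at h
          linear_combination h
    | bwd μ =>
      cases t with
      | fwd ν =>
        by_cases hμν : μ = ν
        · subst hμν; rfl
        · exfalso; apply single_ne_single' hμν
          simp only [Step.applyZd_fwd, Step.applyZd_bwd] at h
          linear_combination -h
      | bwd ν =>
        exfalso; apply single_add_single_ne_zero' μ ν
        simp only [Step.applyZd_bwd] at h
        linear_combination -h
  · rintro rfl
    exact Step.applyZd_inv_applyZd x s

/-! ## The walk of a word -/

/-- **The walk of a word**: one dart per letter, from `x` to `endpointZd x w`. [folklore] -/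
def Word.toWalkZd : (x : Site d) → (w : Word d) → (zdGraph d).Walk x (Word.endpointZd x w)
  | _, [] => Walk.nil
  | x, s :: w => Walk.cons (Step.adj_applyZd x s) (Word.toWalkZd (s.applyZd x) w)

/-- The walk of a word has the word's length. [folklore] -/
@[simp] theorem Word.length_toWalkZd : ∀ (x : Site d) (w : Word d), (Word.toWalkZd x w).length = w.length
  | _, [] => rfl
  | x, s :: w => congrArg (· + 1) (Word.length_toWalkZd (s.applyZd x) w)

section Holonomy

variable {G : Type*} [Group G]

/-- The dart of a step carries the step holonomy. [folklore] -/
theorem dartHolonomy_step (U : LGConfig d G) (x : Site d) (s : Step d) :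
    dartHolonomy U ⟨(x, s.applyZd x), Step.adj_applyZd x s⟩ = stepHolonomyZd U x s := by
  cases s with
  | fwd μ => exact dartHolonomy_of_eq_add U _ x μ rfl rfl
  | bwd μ =>
    rw [stepHolonomyZd_bwd]
    exact dartHolonomy_of_eq_sub U _ (x - Pi.single μ 1) μ (by simp) rfl

/-- ★ **The walk of a word has the word's holonomy** on every configuration. [folklore] -/
theorem walkHolonomy_toWalkZd (U : LGConfig d G) : ∀ (x : Site d) (w : Word d),
    walkHolonomy U (Word.toWalkZd x w) = wordHolonomyZd U x w
  | _, [] => by simp [Word.toWalkZd]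
  | x, s :: w => by
    show walkHolonomy U (Walk.cons (Step.adj_applyZd x s) (Word.toWalkZd (s.applyZd x) w)) = _
    rw [walkHolonomy_cons, wordHolonomyZd_cons, walkHolonomy_toWalkZd U (s.applyZd x) w, dartHolonomy_step]

end Holonomy

/-- **The closed walk of a closed word** (`endpointZd x w = x`). [folklore] -/
def Word.toLoopZd (x : Site d) (w : Word d) (hw : Word.endpointZd x w = x) : (zdGraph d).Walk x x :=
  (Word.toWalkZd x w).copy rfl hw

/-- The closed walk has the word's holonomy. [folklore] -/
theorem walkHolonomy_toLoopZd {G : Type*} [Group G] (U : LGConfig d G) (x : Site d) (w : Word d) (hw : Word.endpointZd x w = x) :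
    walkHolonomy U (Word.toLoopZd x w hw) = wordHolonomyZd U x w := by
  rw [Word.toLoopZd, walkHolonomy_copy, walkHolonomy_toWalkZd]

/-- The closed walk has the word's length. [folklore] -/
@[simp] theorem Word.length_toLoopZd (x : Site d) (w : Word d) (hw : Word.endpointZd x w = x) :
    (Word.toLoopZd x w hw).length = w.length := by
  rw [Word.toLoopZd, Walk.length_copy, Word.length_toWalkZd]

/-! ## Cyclically reduced words give non-backtracking loops -/

/-- **Cyclically reduced**: non-empty, and no letter is followed — cyclically — by its inverse
(decidable). [folklore] -/
def Word.CyclicallyReduced (w : Word d) : Prop :=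
  w ≠ [] ∧ List.IsChain (fun s t => t ≠ s.inv) (w ++ w.take 1)

/-- `CyclicallyReduced` is decidable (word data only; `decide` for concrete words). [folklore] -/
instance (w : Word d) : Decidable w.CyclicallyReduced := inferInstanceAs (Decidable (_ ∧ _))

/-- The dart of the step `s` at `x`. [folklore] -/
def stepDart (x : Site d) (s : Step d) : (zdGraph d).Dart := ⟨(x, s.applyZd x), Step.adj_applyZd x s⟩

/-- Consecutive step darts do not backtrack iff the steps are not inverse. [folklore] -/
theorem stepDart_ne_symm_iff (x : Site d) (s t : Step d) :
    stepDart (s.applyZd x) t ≠ (stepDart x s).symm ↔ t ≠ s.inv := by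
  rw [not_iff_not, Dart.ext_iff]
  simp only [stepDart, Dart.symm_toProd, Prod.swap_prod_mk, Prod.mk.injEq, true_and]
  exact Step.applyZd_applyZd_eq_iff x s t

/-- The darts of the walk of a word, with one extra step dart appended at the endpoint, do not backtrack
iff the word with that step appended has no adjacent inverse pair. [folklore] -/
theorem isChain_darts_toWalkZd_append : ∀ (x : Site d) (w : Word d) (t : Step d),
    List.IsChain (fun a b => b ≠ a.symm) ((Word.toWalkZd x w).darts ++ [stepDart (Word.endpointZd x w) t]) ↔
      List.IsChain (fun s t => t ≠ s.inv) (w ++ [t])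
  | x, [], t => by simp [Word.toWalkZd]
  | x, [s], t => by
    simp only [Word.toWalkZd, Walk.darts_cons, Walk.darts_nil, List.cons_append, List.nil_append, List.isChain_pair,
      Word.endpointZd_cons, Word.endpointZd_nil]
    exact stepDart_ne_symm_iff x s t
  | x, s :: u :: w, t => by
    have ih := isChain_darts_toWalkZd_append (s.applyZd x) (u :: w) t
    simp only [Word.toWalkZd, Walk.darts_cons, List.cons_append, List.isChain_cons_cons, Word.endpointZd_cons] at ih ⊢
    rw [ih]
    exact and_congr_left fun _ => stepDart_ne_symm_iff x s u

/-- ★★ **A cyclically reduced closed word is a non-backtracking closed walk** (SZZ's sense) with the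
word's holonomy and length. [folklore] -/
theorem isNonBacktrackingLoop_toLoopZd (x : Site d) (w : Word d) (hw : Word.endpointZd x w = x) (hred : w.CyclicallyReduced) :
    IsNonBacktrackingLoop (Word.toLoopZd x w hw) := by
  obtain ⟨hne, hchain⟩ := hred
  refine ⟨by rw [Word.length_toLoopZd]; exact List.length_pos_of_ne_nil hne, ?_⟩
  rw [Word.toLoopZd, Walk.darts_copy]
  obtain ⟨s, w', rfl⟩ := List.exists_cons_of_ne_nil hne
  have htake : (Word.toWalkZd x (s :: w')).darts.take 1 = [stepDart x s] := by
    simp [Word.toWalkZd, stepDart]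
  have e : stepDart (Word.endpointZd x (s :: w')) s = stepDart x s := by rw [hw]
  rw [htake, ← e, isChain_darts_toWalkZd_append]
  simpa using hchain

/-! ## The strong-coupling concentration for cyclically reduced words (given SZZ) -/

/-- ★★ **`Γ_{μ_N}(C,C) ≤ 4 n(n−3)/(c₀N²)` for every cyclically reduced closed word `C` of length `n`**
(given SZZ (1.12); `d ≥ 2`, `|βt| < 1/(16(d−1))`, `N ≥ 1`, `μ` a thermodynamic limit point of the `SU(N)`
torus states at tree coupling `N·βt`) — no walk data needed. [cite: ShenZhuZhuCMP2023, Corollary 1.5] -/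
theorem loopImCov_le_of_szz_of_cyclicallyReduced (hfact : ∀ N, shenZhuZhu_largeN_variance d N) (hd : 2 ≤ d) {βt : ℝ}
    (hβ : |βt| < szzThresholdSU d) (hN : 1 ≤ N) {μ : Measure (LGConfig d (Matrix.specialUnitaryGroup (Fin N) ℂ))}
    (hμ : μ ∈ infiniteVolumeLimitPoints (d := d) (fundamentalRep (Fin N)) ((N : ℝ) * βt))
    (x : Site d) (C : Word d) (hC : Word.endpointZd x C = x) (hred : C.CyclicallyReduced) :
    loopImCov (fundamentalRep (Fin N)) μ x C C ≤
      4 * ((C.length : ℝ) * ((C.length : ℝ) - 3)) / szzPlanarSlope d βt / (N : ℝ) ^ 2 := by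
  have h := loopImCov_le_of_szz hfact hd hβ hN hμ x C (Word.toLoopZd x C hC) (isNonBacktrackingLoop_toLoopZd x C hC hred)
    fun U => walkHolonomy_toLoopZd U x C hC
  rwa [Word.length_toLoopZd] at h

/-- ★★ **Concentration for cyclically reduced closed words** along any limit points `μ_N` (given SZZ):
`Γ_{μ_N}(C, C) → 0`. [cite: ShenZhuZhuCMP2023, Corollary 1.5] -/
theorem tendsto_loopImCov_zero_of_szz_of_cyclicallyReduced (hfact : ∀ N, shenZhuZhu_largeN_variance d N) (hd : 2 ≤ d)
    {βt : ℝ} (hβ : |βt| < szzThresholdSU d)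
    (μ : (N : ℕ) → Measure (LGConfig d (Matrix.specialUnitaryGroup (Fin N) ℂ)))
    (hμ : ∀ N, 1 ≤ N → μ N ∈ infiniteVolumeLimitPoints (d := d) (fundamentalRep (Fin N)) ((N : ℝ) * βt))
    (x : Site d) (C : Word d) (hC : Word.endpointZd x C = x) (hred : C.CyclicallyReduced) :
    Tendsto (fun N => loopImCov (fundamentalRep (Fin N)) (μ N) x C C) atTop (𝓝 0) :=
  tendsto_loopImCov_zero_of_szz hfact hd hβ μ hμ x C (Word.toLoopZd x C hC) (isNonBacktrackingLoop_toLoopZd x C hC hred)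
    fun _ U => walkHolonomy_toLoopZd U x C hC

/-- **SZZ's variance bound for cyclically reduced closed words**: `Var(Re t_C) + Var(Im t_C) ≤ 4 n(n−3)/(c₀N²)`.
[cite: ShenZhuZhuCMP2023, Corollary 1.5] -/
theorem variance_loopTrZd_le_of_szz_of_cyclicallyReduced (hfact : ∀ N, shenZhuZhu_largeN_variance d N) (hd : 2 ≤ d)
    {βt : ℝ} (hβ : |βt| < szzThresholdSU d) (hN : 1 ≤ N) {μ : Measure (LGConfig d (Matrix.specialUnitaryGroup (Fin N) ℂ))}
    (hμ : μ ∈ infiniteVolumeLimitPoints (d := d) (fundamentalRep (Fin N)) ((N : ℝ) * βt))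
    (x : Site d) (C : Word d) (hC : Word.endpointZd x C = x) (hred : C.CyclicallyReduced) :
    Var[fun U => (loopTrZd (fundamentalRep (Fin N)) x C U).re; μ] + Var[fun U => (loopTrZd (fundamentalRep (Fin N)) x C U).im; μ] ≤
      4 * ((C.length : ℝ) * ((C.length : ℝ) - 3)) / szzPlanarSlope d βt / (N : ℝ) ^ 2 := by
  have h := variance_loopTrZd_le_of_szz hfact hd hβ hN hμ x C (Word.toLoopZd x C hC) (isNonBacktrackingLoop_toLoopZd x C hC hred)
    fun U => walkHolonomy_toLoopZd U x C hC
  rwa [Word.length_toLoopZd] at h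

/-- Sanity instance: the plaquette word is cyclically reduced (`decide` on the letters). [folklore] -/
theorem cyclicallyReduced_plaqWord_example : (plaqWord (0 : Fin 2) 1 true).CyclicallyReduced := by decide

end Summit.QuantumFields.GaugeBoot

end
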